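import Mathlib
import HarnessLib
import HarnessLib.Audit
import Summits.Langlands.Statement
import Literature.NumberTheory.Automorphic.NiceTwistedStandardL
import HarnessLib.Audit.Status.Attr

/-!
Route: MonomialConverse

# Route MonomialConverse — GL1-twist converse conjecture alone decides strong Artin via abelian-free
monomials

PROGRAM-EMBEDDING (lens 3.13, switched to program-completion as the brief prescribes: the embedding
is Piatetski-Shapiro's converse
philosophy + Murty's 1993 Main Theorem). Host F = analytic theory of automorphic L-functions;
structural conjecture C = the
Cogdell–Piatetski-Shapiro GL1-twist converse conjecture (CPS 1994 p. 166: all GL1-twists of L(Π,s)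
nice ⇒ Π quasi-automorphic);
special case C0 = C for the admissible representations Π(Ind_K^F λ) attached to ABELIAN-FREE
monomial Artin representations (λ a
character of Γ_K that is not the restriction of a character of Γ_F), whose GL1-twists are ENTIRE
Hecke L-functions of K, so that the
hypothesis of C holds unconditionally (Hecke 1920) = the support MonomialInduction. It suffices to
show CPSConverseGL1 ∧
AbelianFreeBrauer (every irreducible character of degree ≥ 2 of a finite group is a ℤ-combination of
abelian-free monomial characters):
then Brauer's virtual decomposition runs through abelian-free pieces only, each piece is a unitary
isobaric automorphic class by C0, and
Jacquet–Shalika norm-one rigidity collapses the virtual class of ρ to one cuspidal π (Murty 1993;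
Arthur–Clozel III.7.2): strong Artin
for every irreducible ρ of dimension ≥ 2 over every number field (target StrongArtinAE), in
particular every even icosahedral ρ over ℚ,
whence the summit through the shared junction EvenArtinJunction. A BRIDGE CONDITIONAL ON
CPSConverseGL1, which is a LISTED CRUX
(rank 2) and a hypothesis of `closes` (the gate's `conditional_on` flag is not set because the
conjecture is new to the tree, not an
accepted declaration; the two-crux floor is met anyway).
Lean: `CPSConverseGL1 ∧ AbelianFreeBrauer`

## Assembly
Pure logic (sorry-free in Sketch.lean, `closes` and `assembly_holds`): HeckeNiceBridge applied to
CPSConverseGL1 gives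
MonomialInduction; MurtyGlue with AbelianFreeBrauer gives StrongArtinAE; its instance F = ℚ, n = 2
(le_rfl), with the icosahedral-image
and evenness hypotheses ignored, is the antecedent of EvenArtinJunction, which returns the summit
constant. Deciding theorem:
`closes (hC : CPSConverseGL1) (hK : AbelianFreeBrauer) (hB : HeckeNiceBridge) (hG : MurtyGlue) (hJ :
EvenArtinJunction) : Langlands :=
hJ (fun ρ hirr _ _ => hG (hB hC) hK ℚ 2 le_rfl ρ hirr)` — both cruxes load-bearing; the three
supports are theorem-level (two) and the
sector junction (one).

Rationale: WHY THIS LINE. The naive use of converse theorems for Artin representations needs Artin's holomorphy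
conjecture for all twists (Booker2003 removed
the twists only for n = 2 over ℚ), and Murty's bridges need either Selberg's Conjecture B
(Murty1994, card selberg-orthonormality-bridge:
closed known) or automorphic induction of EVERY Hecke character of every K
(book:gouvea1993-advances-number-theory-proceedings-third-conference-canadian
p. 56, Main Theorem), where characters whose induction has an abelian constituent give twisted
L-functions with ζ_K-type poles and
void the hypothesis of the printed CPS conjecture (CogdellPiatetskishapiro1994 p. 166 asks for
ENTIRE twists). The new cut: abelian-free
monomial pieces have entire Hecke twists (hypothesis of C verbatim, no conjecture needed), and the
finite-group crux AbelianFreeBrauer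
says they suffice in Brauer's theorem for every irreducible of degree ≥ 2 (checked by hand for S3,
Q8, A4, SL2(F3), A5 and for every
genuine irreducible of SL2(F5) — so the even icosahedral case is covered as typed; GAP sweep of all
groups of order ≤ 63 submitted,
job j022016). Imported area: analytic theory of automorphic L-functions (converse theorems:
JacquetLanglands1970 Thm 12.2, JPSS non-normal
cubic induction, CogdellPiatetskishapiro1994/1999, Jacquet–Liu arXiv:1604.02033) and finite-group
character theory (Brauer 1947); the
glue is Rankin–Selberg rigidity (JacquetShalikaAJM1981II) plus the order of Artin L-functions at s =
1 (tree: ArtinLFunctionOrderAtOne).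
What listed routes do not do: TwistAveragedDeinduction uses the CPS conjecture for induction TO ℚ in
direction (A); the six even-Artin
routes use p-adic doors; none derives the Artin sector of (B) from the printed GL1-converse
conjecture.

RANKED CRUXES. #0 StrongArtinAE (target) — strong Artin conjecture in the almost-everywhere form for
every number field F and every irreducible Artin representation ρ : Γ_F → GL_n(ℂ) with n ≥ 2: a
cuspidal π of GL_n(𝔸_F) whose Satake polynomial at almost every v is the arithmetic-Frobenius
polynomial of ρ (same clause as EvenIcosahedralStrongArtin of route EvenArtinGL4Door, which it
specialises to). (why it might fail: It is strong Artin for all n ≥ 2 over all F (false only with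
the summit); as typed (a.e. Satake form, ∃ hcpt π) it has the vacuity status of
EvenIcosahedralStrongArtin (route EvenArtinGL4Door), which it contains.) [BuzzardGeeLMS2014,
Tunnell1981, Gelbart1997, ArthurClozelAMS120]
#2 CPSConverseGL1 (crux) — THE CONDITION OF THE BRIDGE — Cogdell–Piatetski-Shapiro's GL1-twist
converse conjecture (Publ. IHES 79 p. 166) over every number field K and every N ≥ 1, in the
ANALYTIC form over the tree's carrier: for a factorizable datum D (Satake family α off a finite S
with a polynomial bound, Hecke central character, local factors of all GL1-twists, Γ-shifts, ε =
W·C^(1/2−s)) all of whose GL1-twisted completed L-functions are nice (entire, bounded in vertical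
strips, functional equation), some automorphic P on GL_N(𝔸_K) has Satake parameter α_v at almost
every v (quasi-automorphy; Π' ≠ Π is allowed, as PS's N = 4 examples require). [difficulty:
open-problem] (why it might fail: Open for N ≥ 4 since 1994 with no technique reducing the twisting
set below GL_{N−2}; PS's examples give Π' ≠ Π at N = 4; the analytic form (free data at S, ∞, ε) is
stronger than the printed conjecture and a junk-datum counterexample may exist.)
[CogdellPiatetskishapiro1994, CogdellPiatetskishapiro1999, arXiv:1604.02033, arXiv:math/0304230,
JacquetLanglands1970]
#3 AbelianFreeBrauer (crux) — finite group theory — for every finite group G and every irreducible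
complex representation V of dimension ≥ 2, the character of V is a ℤ-linear combination of induced
class functions Ind_H^G φ with φ a linear character of a subgroup H that is NOT the restriction of
any linear character of G (equivalently ⟨Ind φ, χ⟩ = 0 for every linear χ of G: the piece is
abelian-free). Verified by hand for S3, Q8, A4, SL2(F3), A5 and all genuine irreducibles of SL2(F5);
it is exactly what lets the PRINTED conjecture (entire twists) replace Murty's hypothesis (induction
of every Hecke character). [difficulty: M] (why it might fail: Unfound in print as a theorem; a
solvable group with large abelianisation and sparse subgroup lattice could break the ℤ-span (GAP
sweep of all groups of order ≤ 63 running, job j022016) — then restrict to the class containing the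
perfect central extensions.) [Brauer1947, ArthurClozelAMS120,
book:editornd-introduction-langlands-program, doi:10.1016/0021-8693(88)90254-5]
#9 MonomialInduction (support) — C0, the special case of the conjecture the glue consumes (also a
case of Langlands functoriality, automorphic induction for Res_{K/F} GL1 → GL_{[K:F]}, and Murty's
1993 hypothesis restricted to abelian-free characters): for every finite extension K/F of number
fields and every character λ of Γ_K that is not the restriction of a character of Γ_F there are
cuspidal π_1, …, π_r over F whose Satake polynomials at almost every v multiply to ∏_{w∣v} (X^f(w∣v)
− λ(Frob_w)), the Frobenius polynomial of Ind_K^F λ. Known for [K:F] ≤ 3 (JL 1970 Thm 12.2; JPSS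
1981 non-normal cubic). [difficulty: open-problem] [ArthurClozelAMS120, JacquetLanglands1970,
book:gouvea1993-advances-number-theory-proceedings-third-conference-canadian,
CogdellPiatetskishapiro1994]
#9 HeckeNiceBridge (support) — theorem-level bridge C ⇒ C0: for abelian-free λ the datum of
Π(Ind_K^F λ) has every GL1-twisted completed L-function equal to the completed Hecke L-function
Λ_K(s, λ·(ω∘N_{K/F})) of a NON-principal character (local Langlands for GL_d × GL_1 preserves L and
ε, inductivity of Artin L-factors at every place and of the global root number; abelian-freeness
excludes principal twists), hence nice (Hecke 1920 / Tate; bounded in strips by the theta integral);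
the conjecture gives an automorphic P with the induced Satake family; Langlands'
constituent-of-induced lemma and the unit modulus of the Satake parameters (roots of unity) force
the cuspidal data to be unitary with exponents 0, i.e. the cuspidal pieces of MonomialInduction.
[difficulty: L] [HeckeMathZ1920, CogdellPiatetskishapiro1994, HarrisTaylorAMS2001,
LanglandsCorvallis1979Notion, DeligneAntwerpII1973]
#9 HeckeLambdaNice (support; added 2026-08-17 by the cone repair) — the ANALYTIC INPUT of
HeckeNiceBridge as a typed lemma naming the import cone's one unproved Literature fact
(heckeLFunction_functional_equation, general unitary case) in the stronger currency the bridge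
consumes: for every number field K and every unitary non-norm-twist Hecke character χ there are A ∈
ℕ_{>0}, shifts a, a′, |W| = 1 and ENTIRE Λ, Λ′ bounded in vertical strips with Λ = γ_a·L(χ, ·), Λ′ =
γ_{a′}·L(χ⁻¹, ·) on Re s > 1 and Λ(s) = W·A^{1/2−s}·Λ′(1−s) (Hecke 1920 / Tate Thm 4.4.1 / Neukirch
VII (8.6); strips: Godement–Jacquet Thm 13.8, n = 1). [difficulty: L] [TateThesis1967,
HeckeMathZ1920, NeukirchANT1999, GodementJacquet1972, JacquetLanglands1970]
#9 HeckeNiceBridgeOfLambda (support; added 2026-08-17) — HeckeLambdaNice → CPSConverseGL1 →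
MonomialInduction, the FORMAL remainder of HeckeNiceBridge (datum of Π(Ind_K^F λ) over the carrier,
regrouping of Hecke Euler products and Γ-shifts along w ∣ v, central character via
artinReciprocity_character_holds, CPS output ↦ unitary cuspidal data). HeckeLambdaNice and
HeckeNiceBridgeOfLambda give HeckeNiceBridge by modus ponens (a `--split` was refused to this seat:
final-cycle-only rule). [difficulty: L] [CogdellPiatetskishapiro1994, TateThesis1967,
LanglandsCorvallis1979Notion, JacquetShalikaAJM1981II]
#9 MurtyGlue (support) — theorem-level implication C0 ∧ AbelianFreeBrauer ⇒ StrongArtinAE = the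
proof of Murty's 1993 Main Theorem / Arthur–Clozel Prop. III.7.2 run through abelian-free pieces:
write ρ = Σ n_i Ind λ_i virtually (AbelianFreeBrauer on the finite image, inflated), replace each
piece by its cuspidal classes (MonomialInduction) to get a virtual class A = Σ m_σ [σ]; ∏
L^S(σ×σ'^∨)^(m m') = L^S(s, ρ⊗ρ^∨) has order −⟨ρ,ρ⟩ = −1 at s = 1 (Jacquet–Shalika poles and
non-vanishing; Artin order at 1, tree ArtinLFunctionOrderAtOne), so Σ m_σ² = 1 and A = ±[σ0]
(normOne_rigidity, proved in Sketch.lean); comparing Euler factors det(1 − ρ(Frob_v)X)^(−1) = det(1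
− A_{σ0,v}X)^(∓1) excludes the minus sign and gives σ0 on GL_n with the Frobenius polynomials of ρ
a.e. [difficulty: L] [book:gouvea1993-advances-number-theory-proceedings-third-conference-canadian,
ArthurClozelAMS120, JacquetShalikaAJM1981II, Murty1994, Brauer1947]
#9 EvenArtinJunction (support) — the rest of the summit beyond the even icosahedral sector over ℚ
(the shared junction of routes EvenArtinGL4Door / EvenIcosahedralCMCorner, identical statement: NOT
to be staffed from this route); the deciding theorem feeds it the F = ℚ, n = 2 instance of
StrongArtinAE with the icosahedral and evenness hypotheses discarded. [difficulty: open-problem]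
[BuzzardGeeLMS2014, Gelbart1997, DoudMoore2006]

TWO-LAYER PLAN. CPSConverseGL1 ⇐ TwistPropagation (GL1-niceness of all twists of D forces niceness
of its twists by cuspidal τ on GL_m, m ≤ N − 2) →
CPSIITheorem (CogdellPiatetskishapiro1999 Thm 2: twists by GL_{≤N−2} ⇒ quasi-automorphic,
theorem-level) → CPSConverseGL1.
AbelianFreeBrauer ⇐ BrauerInduction (1947; absent from Mathlib, M-sized) → PermutationExchange
(χ·Ind_H^G 1 is, modulo the ℤ-span of
abelian-free monomials, a ℤ-combination of linear characters) → AbelianFreeBrauer (orthogonality of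
linear characters finishes).
MonomialInduction, if attacked unconditionally: degree ≤ 3 (theorem-level, JL/JPSS) and, for K
totally real (the even Artin case), a
restricted-twist converse theorem over ℚ with twists by GL1 and regular algebraic cusp forms whose
base change to K exists
(Dieulefait 2012, BLGGT), so that every twisted L-function is a known Rankin–Selberg L-function over
K.

KILL CRITERIA. (i) AbelianFreeBrauer refuted by a finite group (GAP certificate) ⇒ restate on the
class where it holds (must contain 2.A5 ∘ C_m, A5,
PSL2(7), the Hessian group for the flagship cases) — misstated-type repair; refuted FOR SL2(F5) ⇒
the flagship even-icosahedral
consequence dies, close refuted:AbelianFreeBrauer. (ii) CPSConverseGL1 refuted in its analytic form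
by a junk carrier datum ⇒ restate
over genuine factorizable Π (definition request D1), misstated; refuted by a GENUINE Π of GL_N, N ≥
4, with all GL1-twists nice and
no quasi-automorphic partner ⇒ PS's conjecture is false, close refuted:CPSConverseGL1 (a field-level
event). (iii) MonomialInduction
proved unconditionally (trace formula / beyond endoscopy) ⇒ re-glue `closes` on it and drop the
condition (the bridge becomes a
theorem). (iv) EvenIcosahedralStrongArtin proved by a door route ⇒ replace the junction by a general
Artin junction; the bridge still
covers all n.

NOT DECOMPOSED YET. The internals of HeckeNiceBridge (local Langlands factor matching at ramified
places, global inductivity of ε, Langlands' constituent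
lemma, unit-modulus cleanup) and of MurtyGlue (inflation from the finite image with Mackey
bookkeeping, Jacquet–Shalika pole orders,
Artin order at s = 1, Euler-factor sign — abstract cores normOne_rigidity and sign_step proved in
Sketch.lean) are theorem-level and split
only when a prover claims them; the upgrade of a.e. matching to Corresponds at every place, n = 1
(class field theory) and all of
direction (A) live in the junction; the stubs of the two birth skeletons
(TwistPropagation/CPSIITheorem, BrauerInduction/PermutationExchange)
are registered lines, not items.
 CONE REPAIR 2026-08-17 (planner-rrepair, gen 1; priority guardrail `blocked-by-cone (13)`). The
route file imports the summit Statement's cone plus ONE module,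
Literature.NumberTheory.Automorphic.NiceTwistedStandardL (the carrier of CPSConverseGL1), which adds
exactly four modules to that cone — Automorphic.AutomorphicLFunction,
Automorphic.NiceTwistedStandardL, GaloisRepresentations.ArtinLFunction,
GaloisRepresentations.HeckeCharacter — and among their named facts exactly ONE is unproved (`lean
search '_holds'`, 2026-08-17):
Literature.NumberTheory.GaloisRepresentations.heckeLFunction_functional_equation (XL; finite-order
case proved: heckeLFunction_functional_equation_of_isFiniteOrder; entire/meromorphic continuation
proved via Godement–Jacquet rank one; residue = Tate's adelic FE for unitary Größencharaktere of
infinite order). The other twelve counted facts are not in these four modules (summit Statement's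
own cone, shared by every Langlands route, or census skew; the cone inventory
run/shared/views/cone/Langlands.md was not visible from the repair seat); gate-side deps: 0 unproved
among 448 constants. NO RE-ROUTE at route level: TwistedStandardLData indexes GL1-twists by
`HeckeCharacter K`, so every faithful typing of the PRINTED conjecture imports HeckeCharacter.lean;
the fact rides in on that module although no route declaration uses it. PROOF-TIME named facts this
line genuinely leans on (needs-fact, tier-0 debt): (in cone) heckeLFunction_functional_equation —
consumed by HeckeNiceBridge through the typed support HeckeLambdaNice (ω ranges over ALL Hecke
characters of F, so λ·(ω∘N_{K/F}) is a unitary Größencharakter of K of infinite order up to a real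
norm shift; the bridge needs its completed L-function entire, bounded in vertical strips, with ε =
W·A^{1/2−s}, A ∈ ℕ); (not imported, invisible to the cone)
JacquetShalika1981_partialPairL_boundary_repData and JacquetShalika1981_partialPairL_pole_repData
(PairLFunctionPolesRepData; Arthur–Clozel Ch. 3 (2.2)/(2.3)) — consumed by MurtyGlue, shared debt
with crux PairLBoundaryJS (stmt-Langlands-13622) of route IrreducibilityBySelfDuality. Already
PROVED and used at proof time: artinLFunction_order_at_one_holds, artinReciprocity_character_holds,
CuspidalAutomorphicRepData.exists_contragredient_satake_holds,
JacquetShalika1981_multipliable_partialPairL_repData_holds, multipliable_heckeLFunction_holds, every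
fact of AutomorphicLFunction and ArtinLFunction. NOT needed:
HeckeCharacter.exists_of_dirichletCharacter / exists_dirichletCharacter_of_isFiniteOrder,
heckeLFunction_hasMeromorphicContinuation (all proved anyway). CONE HYGIENE (operator/librarian, no
route change): move §Hecke L-functions of HeckeCharacter.lean (heckeLFunction,
multipliable_heckeLFunction, archGammaFactor, the three continuation/FE facts, §Rat) into a module
HeckeLFunction.lean — NiceTwistedStandardL needs only the structure, IsUnramifiedAt and
valueAtUniformizer — and this route's module cone is clean while the fact keeps its tier-0 seat for
HeckeLambdaNice.
CHEAPEST FALSIFIER. AbelianFreeBrauer on all groups of order ≤ 63 plus A5, SL2(5), 2.A5∘C4, S5,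
PSL2(7), SL2(7), PSL2(8), PSL2(11), SL2(11), A6, S6, A7,
PSL3(3), M11, Hessian 216, 3.A6 — one GAP run (kit job j022016 submitted this session; by hand: S3,
Q8, A4, SL2(F3), A5, SL2(F5) pass).
For CPSConverseGL1: the N = 1 instance of the analytic form must reduce to Hecke–Tate's converse
(all twists of a degree-1 Euler
product nice ⇒ Hecke character) — a refuter's vacuity audit of the carrier at N = 1 decides whether
the analytic form over-claims.

NUMBERS. CPS conjecture known for N ≤ 3 (JL 1970 Thm 11.3/12.2; JPSS 1979/1981), open for N ≥ 4,
with Π' ≠ Π examples at N = 4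
(CogdellPiatetskishapiro1994 p. 166); theorem-level twisting sets: GL_{≤N−1} (CPS 1994 Thm 1),
GL_{≤N−2} (CPS 1999), local converse
⌊N/2⌋ (Jacquet–Liu arXiv:1604.02033). Abelian-free monomial pieces realising the genuine
irreducibles of SL2(F5): induced from C10, C6,
C4 (indices 12, 20, 30), so the even icosahedral case uses the conjecture for GL_12, GL_20, GL_30
over ℚ (times the order of the
central character); A5 irreducibles 3, 3', 4, 5: indices 12, 20, 15, 30. Smallest even icosahedral
conductor 1951 (DoudMoore2006).

DEFINITION REQUESTS. (D1) GenuineTwistedPi (Literature/NumberTheory/Automorphic): a factorizable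
admissible Π = ⊗'Π_v of GL_N(𝔸_K) with its JPSS / Jacquet–Shalika
local L- and ε-factors of GL1-twists, mapping to TwistedStandardLData — to state CPS in printed (not
analytic) strength. (D2)
FramedGaloisRep.induce (Literature/NumberTheory/GaloisRepresentations): Ind_K^F of a framed
representation along [Algebra F K] with
its Frobenius-polynomial lemma (inducedSatakePolynomial) — to split MurtyGlue with typed Mackey
bookkeeping. Filed after open with
`ledger workitem add --kind definition`.

Novelty: Searches (2026-08-17): lit search --hybrid "automorphic induction arbitrary extensions Brauer strong
Artin isobaric Jacquet Shalika" (15, AC book p. 188 read: Prop III.7.2); lit read CPS 1994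
doi:10.1007/bf02698889 pp. 165–166 (Conjecture + "fundamental applications to lifting"); lit read
arXiv:math/0304230 (CPS ICM 2002; no Artin consequence stated); lit read
book:editornd-introduction-langlands-program pp. 69–75, 248–253 (Brauer, AI, converse); lit galaxy
search "combination of monomial characters" --star all (4: Gouvêa–Yui, Murty–Murty, Moroz,
Bernstein–Gelbart); lit read book:gouvea1993-… pp. 36–62 (Murty 1993 Main Theorem p. 56 read); lit
search s2 "Cogdell Piatetski-Shapiro converse theorems functoriality applications" (19); zbMATH
"Brauer induction monomial without trivial constituent" (0); lean search
NiceTwistedStandardL|AllTwistsNice (no Summit item types the CPS conjecture); closed card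
selberg-orthonormality-bridge (Murty 1994, graded known) read.
Nearest prior art found:
book:gouvea1993-advances-number-theory-proceedings-third-conference-canadian p. 56 (Murty 1993 Main
Theorem: induction of EVERY Hecke character of every K ⇒ Artin + strong Artin, by Brauer + JPSS norm
one) and ArthurClozelAMS120 Prop. III.7.2 (same mechanism for accessible characters); the in-house
barrier audit Literature.Barriers.Langlands.SolvableImageBarrierNarrowInduction (2026-08-15: "what
is missing is AUTOMORPHIC INDUCTION along the fixed fields of Brauer's elementary subgroups",
Green's  [refs: 10.1007/bf02698889, math/0304230, doi:10.1007/bf02698889, book:editornd-introduction-langlands-program, book:gouvea1993-, book:gouvea1993-advances-number-theory-proceedings-third-conference-canadian, CogdellPiatetskishapiro1994]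

Barriers (technique_class: converse-theorem, brauer-induction, rs-rigidity): - technique_class: converse-theorem, brauer-induction, rs-rigidity
- Literature.Barriers.Langlands.NonRegularWeightBarrier: evaded — no weights, no cohomology, no
p-adic interpolation: Artin-type π(ρ) (weight 0, Maass λ = 1/4 over ℚ) is the MOST irregular case
and converse theorems are weight-blind (JL Thm 12.2 already produces Maass's even dihedral forms).
- Literature.Barriers.Langlands.ShimuraVarietyRealizationBarrier: evaded — nothing is realised in
cohomology; F is arbitrary.
- Literature.Barriers.Langlands.SolvableImageBarrier: evaded in mechanism — no base change along the
image; the insoluble closure is paid for by INDUCTION of characters along non-normal K/F (an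
L-homomorphism case) fed by GL1-twisted converse theorems that never see the Galois closure (JPSS
non-normal cubic is the prototype); honest residue: for [K:F] ≥ 4 the conjecture is open.
- Literature.Barriers.Langlands.SolvableImageBarrierNarrow: same; Brauer is used for automorphy of
abelian-free monomial pieces, not for meromorphy of L(ρ).
- Literature.Barriers.Langlands.SolvableImageBarrierNarrowInduction: evaded by construction and
ADDRESSED — the route never base-changes, induces or descends along a sub-solvable layer of the
image (the blocked chain class); it supplies exactly the audit's un-blocked missing functoriality,
automorphic induction along non-normal layers with insoluble closure (for icosahedral ρ the audit's
quintic/sextic A₅-layers, or the cyclic layers C10/C6/C4 of 2.A5 used here), from th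

History (route lifecycle, newest last):
- 2026-08-24T18:49:22Z · DORMANT — reconciler: no traction for 7 d (last activity item-evidence-added at 2026-08-17T18:33:46Z); parked, not closed — `ledger route dormant route-Langlands-Monomial (operator:999:3720445)
- 2026-08-29T09:42:00Z · REACTIVATED — reconciler: reactivated — activity statement-checked at 2026-08-29T08:15:59Z after parking at 2026-08-24T18:49:22Z (operator:999:3752210)

sub-problem: Langlands · status: open · opened planner-plan-lens3-Langlands-embed-g2-0 2026-08-17T02:46:48Z · rev 1 · ledger route-Langlands-MonomialConverse
GENERATED by the gate from the ledger (D-0016/17). Provers cite these decls: `theorem foo : Summit.Langlands.Langlands.Theses.MonomialConverse.<Decl> := …` in Summits/Langlands/Langlands/Theorems/<Name>.lean.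
-/

namespace Summit.Langlands.Langlands.Theses.MonomialConverse

open scoped BigOperators Topology Manifold Classical MeasureTheory ProbabilityTheory Matrix InnerProductSpace ComplexConjugate ContinuousMap
open Filter Set Function TopologicalSpace MeasureTheory

attribute [summit_statement] _root_.Langlands

/-- item stmt-Langlands-18578 · target · rank 0 · open · by planner
why it might fail: It is strong Artin for all n ≥ 2 over all F (false only with the summit); as typed (a.e. Satake form, ∃ hcpt π) it has the vacuity status of EvenIcosahedralStrongArtin (route EvenArtinGL4Door), which it contains.
sources: BuzzardGeeLMS2014, Tunnell1981, Gelbart1997, ArthurClozelAMS120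
[target] strong Artin conjecture in the almost-everywhere form for every number field F and every
irreducible Artin representation ρ : Γ_F → GL_n(ℂ) with n ≥ 2: a cuspidal π of GL_n(𝔸_F) whose
Satake polynomial at almost every v is the arithmetic-Frobenius polynomial of ρ (same clause as
EvenIcosahedralStrongArtin of route EvenArtinGL4Door, which it specialises to). -/
@[route_item "route-Langlands-MonomialConverse"]
def StrongArtinAE : Prop :=
  open Literature.NumberTheory.Automorphic Literature.NumberTheory.GaloisRepresentations IsDedekindDomain NumberField in ∀ (F : Type) [Field F] [NumberField F] (n : ℕ), 2 ≤ n → ∀ ρ : FramedGaloisRep F ℂ n, ρ.toGaloisRep.IsIrreducible → ∃ (hcpt : isCompact_glFiniteIntegralLevel n F) (π : CuspidalAutomorphicRepData n F hcpt), ∀ᶠ v : HeightOneSpectrum (RingOfIntegers F) in cofinite, ∃ α : Multiset ℂ, π.1.HasSatakeParamAt v α ∧ ρ.IsUnramifiedAt v ∧ ρ.HasFrobCharpolyAt v (satakePolynomial α)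

/-- item stmt-Langlands-18579 · crux · rank 2 · open · by planner
why it might fail: Open for N ≥ 4 since 1994 with no technique reducing the twisting set below GL_{N−2}; PS's examples give Π' ≠ Π at N = 4; the analytic form (free data at S, ∞, ε) is stronger than the printed conjecture and a junk-datum counterexample may exist.
sources: CogdellPiatetskishapiro1994, CogdellPiatetskishapiro1999, arXiv:1604.02033, arXiv:math/0304230, JacquetLanglands1970
[crux] THE CONDITION OF THE BRIDGE — Cogdell–Piatetski-Shapiro's GL1-twist converse conjecture
(Publ. IHES 79 p. 166) over every number field K and every N ≥ 1, in the ANALYTIC form over the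
tree's carrier: for a factorizable datum D (Satake family α off a finite S with a polynomial bound,
Hecke central character, local factors of all GL1-twists, Γ-shifts, ε = W·C^(1/2−s)) all of whose
GL1-twisted completed L-functions are nice (entire, bounded in vertical strips, functional
equation), some automorphic P on GL_N(𝔸_K) has Satake parameter α_v at almost every v
(quasi-automorphy; Π' ≠ Π is allowed, as PS's N = 4 examples require). [difficulty: open-problem] -/
@[route_item "route-Langlands-MonomialConverse", crux]
def CPSConverseGL1 : Prop :=
  open Literature.NumberTheory.Automorphic IsDedekindDomain NumberField in ∀ (N : ℕ) (K : Type) [Field K] [NumberField K] (D : TwistedStandardLData N K), 1 ≤ N → D.AllTwistsNice → ∃ (hcpt : isCompact_glFiniteIntegralLevel N K) (P : AutomorphicRepData (AutomorphyDatum.gl N K hcpt)), ∀ᶠ v : HeightOneSpectrum (RingOfIntegers K) in cofinite, P.HasSatakeParamAt v (D.α v)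

/-- item stmt-Langlands-18580 · crux · rank 3 · closed · proved by Summit.Langlands.Langlands.Theorems.AbelianFreeBrauer.abelianFreeBrauer_proof (prover) · by planner
why it might fail: Unfound in print as a theorem; a solvable group with large abelianisation and sparse subgroup lattice could break the ℤ-span (GAP sweep of all groups of order ≤ 63 running, job j022016) — then restrict to the class containing the perfect central extensions.
sources: Brauer1947, ArthurClozelAMS120, book:editornd-introduction-langlands-program, doi:10.1016/0021-8693(88)90254-5
[crux] finite group theory — for every finite group G and every irreducible complex representation V
of dimension ≥ 2, the character of V is a ℤ-linear combination of induced class functions Ind_H^G φ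
with φ a linear character of a subgroup H that is NOT the restriction of any linear character of G
(equivalently ⟨Ind φ, χ⟩ = 0 for every linear χ of G: the piece is abelian-free). Verified by hand
for S3, Q8, A4, SL2(F3), A5 and all genuine irreducibles of SL2(F5); it is exactly what lets the
PRINTED conjecture (entire twists) replace Murty's hypothesis (induction of every Hecke character).
[difficulty: M] -/
@[route_item "route-Langlands-MonomialConverse", crux]
def AbelianFreeBrauer : Prop :=
  ∀ (G : Type) [Group G] [Fintype G] (V : FDRep ℂ G), CategoryTheory.Simple V → 2 ≤ Module.finrank ℂ V → ∃ (ι : Type) (_ : Fintype ι) (H : ι → Subgroup G) (φ : ∀ i, H i →* ℂˣ) (m : ι → ℤ), (∀ i, ∀ χ : G →* ℂˣ, χ.restrict (H i) ≠ φ i) ∧ ∀ g : G, V.character g = ∑ i, (m i : ℂ) * ((Nat.card (H i) : ℂ)⁻¹ * ∑ x : G, if h : x * g * x⁻¹ ∈ H i then ((φ i ⟨x * g * x⁻¹, h⟩ : ℂˣ) : ℂ) else 0)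

-- `AbelianFreeBrauer` holds: proved by `Summit.Langlands.Langlands.Theorems.AbelianFreeBrauer.abelianFreeBrauer_proof` (its module imports this route file, so no `_holds` link can be stated here).

/-- item stmt-Langlands-18581 · crux (kind.auto-crux: conjecture-grade) · rank 9 · open · by planner
why it might fail: auto-crux — conjecture-grade statement (docstring avows it ('conjecture')); it is open, so it may simply be false
sources: ArthurClozelAMS120, JacquetLanglands1970, book:gouvea1993-advances-number-theory-proceedings-third-conference-canadian, CogdellPiatetskishapiro1994
[support] C0, the special case of the conjecture the glue consumes (also a case of Langlands
functoriality, automorphic induction for Res_{K/F} GL1 → GL_{[K:F]}, and Murty's 1993 hypothesis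
restricted to abelian-free characters): for every finite extension K/F of number fields and every
character λ of Γ_K that is not the restriction of a character of Γ_F there are cuspidal π_1, …, π_r
over F whose Satake polynomials at almost every v multiply to ∏_{w∣v} (X^f(w∣v) − λ(Frob_w)), the
Frobenius polynomial of Ind_K^F λ. Known for [K:F] ≤ 3 (JL 1970 Thm 12.2; JPSS 1981 non-normal
cubic). [difficulty: open-problem] -/
@[route_item "route-Langlands-MonomialConverse"]
def MonomialInduction : Prop :=
  open Literature.NumberTheory.Automorphic Literature.NumberTheory.GaloisRepresentations IsDedekindDomain NumberField in ∀ (F K : Type) [Field F] [NumberField F] [Field K] [NumberField K] [Algebra F K] (lam : FramedGaloisRep K ℂ 1), (∀ χ : FramedGaloisRep F ℂ 1, lam ≠ χ.restrictField K) → ∃ (r : ℕ) (d : Fin r → ℕ) (hc : ∀ k, isCompact_glFiniteIntegralLevel (d k) F) (π : ∀ k, CuspidalAutomorphicRepData (d k) F (hc k)), ∀ᶠ v : HeightOneSpectrum (RingOfIntegers F) in cofinite, ∀ c : HeightOneSpectrum (RingOfIntegers K) → ℂ, (∀ w : HeightOneSpectrum (RingOfIntegers K), w.asIdeal.under (RingOfIntegers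 F) = v.asIdeal → lam.IsUnramifiedAt w ∧ lam.HasFrobCharpolyAt w (Polynomial.X - Polynomial.C (c w))) → ∃ α : Fin r → Multiset ℂ, (∀ k, (π k).1.HasSatakeParamAt v (α k)) ∧ ∏ k, satakePolynomial (α k) = ∏ᶠ w ∈ {w : HeightOneSpectrum (RingOfIntegers K) | w.asIdeal.under (RingOfIntegers F) = v.asIdeal}, (Polynomial.X - Polynomial.C (c w)).comp (Polynomial.X ^ w.asIdeal.inertiaDeg (RingOfIntegers F))

/-- item stmt-Langlands-18582 · crux (kind.auto-crux: conjecture-grade) · rank 9 · open · by planner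
why it might fail: auto-crux — conjecture-grade statement (docstring avows it ('conjecture')); it is open, so it may simply be false
sources: HeckeMathZ1920, CogdellPiatetskishapiro1994, HarrisTaylorAMS2001, LanglandsCorvallis1979Notion, DeligneAntwerpII1973
[support] theorem-level bridge C ⇒ C0: for abelian-free λ the datum of Π(Ind_K^F λ) has every
GL1-twisted completed L-function equal to the completed Hecke L-function Λ_K(s, λ·(ω∘N_{K/F})) of a
NON-principal character (local Langlands for GL_d × GL_1 preserves L and ε, inductivity of Artin
L-factors at every place and of the global root number; abelian-freeness excludes principal twists),
hence nice (Hecke 1920 / Tate; bounded in strips by the theta integral); the conjecture gives an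
automorphic P with the induced Satake family; Langlands' constituent-of-induced lemma and the unit
modulus of the Satake parameters (roots of unity) force the cuspidal data to be unitary with
exponents 0, i.e. the cuspidal pieces of MonomialInduction. [difficulty: L] -/
@[route_item "route-Langlands-MonomialConverse", crux]
def HeckeNiceBridge : Prop :=
  CPSConverseGL1 → MonomialInduction

/-- item stmt-Langlands-18583 · support · rank 9 · open · by planner
sources: book:gouvea1993-advances-number-theory-proceedings-third-conference-canadian, ArthurClozelAMS120, JacquetShalikaAJM1981II, Murty1994, Brauer1947
[support] theorem-level implication C0 ∧ AbelianFreeBrauer ⇒ StrongArtinAE = the proof of Murty's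
1993 Main Theorem / Arthur–Clozel Prop. III.7.2 run through abelian-free pieces: write ρ = Σ n_i Ind
λ_i virtually (AbelianFreeBrauer on the finite image, inflated), replace each piece by its cuspidal
classes (MonomialInduction) to get a virtual class A = Σ m_σ [σ]; ∏ L^S(σ×σ'^∨)^(m m') = L^S(s,
ρ⊗ρ^∨) has order −⟨ρ,ρ⟩ = −1 at s = 1 (Jacquet–Shalika poles and non-vanishing; Artin order at 1,
tree ArtinLFunctionOrderAtOne), so Σ m_σ² = 1 and A = ±[σ0] (normOne_rigidity, proved in
Sketch.lean); comparing Euler factors det(1 − ρ(Frob_v)X)^(−1) = det(1 − A_{σ0,v}X)^(∓1) excludes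
the minus sign and gives σ0 on GL_n with the Frobenius polynomials of ρ a.e. [difficulty: L] -/
@[route_item "route-Langlands-MonomialConverse", crux]
def MurtyGlue : Prop :=
  MonomialInduction → AbelianFreeBrauer → StrongArtinAE

/-- item stmt-Langlands-18973 · support · rank 9 · open · by planner
sources: TateThesis1967, HeckeMathZ1920, NeukirchANT1999, GodementJacquet1972, JacquetLanglands1970
[support] Hecke 1920 / Tate 1950 in Cogdell–Piatetski-Shapiro currency — the ANALYTIC INPUT of
HeckeNiceBridge, separated by the 2026-08-17 cone repair so that it names the one unproved
Literature fact of this route's import cone,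
Literature.NumberTheory.GaloisRepresentations.heckeLFunction_functional_equation (needs-fact, tier-0
debt; its finite-order case is the tree theorem heckeLFunction_functional_equation_of_isFiniteOrder,
entire continuation is heckeLFunction_hasEntireContinuation_of_not_isNormTwist_holds, meromorphic
continuation heckeLFunction_hasMeromorphicContinuation_holds; the residue is Tate's adelic
functional equation for unitary Größencharaktere of infinite order), in the STRONGER form the bridge
actually consumes: for every number field K and every unitary Hecke character χ of K that is not a
norm twist there are A ∈ ℕ_{>0} (= |d_K|·N𝔣(χ)), archimedean shifts a, a′, a root number W with |W|
= 1 and ENTIRE Λ, Λ′ : ℂ → ℂ, BOUNDED IN VERTICAL STRIPS, with Λ(s) = γ_a(s)·L(χ, s), Λ′(s) =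
γ_{a′}(s)·L(χ⁻¹, s) for Re s > 1 (tree currency: HeckeCharacter.archGammaFactor = Γ_ℝ at real / Γ_ℂ
at complex places; heckeLFunction = Euler product over the idelically unramified pla -/
@[route_item "route-Langlands-MonomialConverse"]
def HeckeLambdaNice : Prop :=
  open Literature.NumberTheory.Automorphic Literature.NumberTheory.GaloisRepresentations NumberField in ∀ (K : Type) [Field K] [NumberField K] (χ : HeckeCharacter K), χ.IsUnitary → ¬ χ.IsNormTwist → ∃ (A : ℕ) (a a' : InfinitePlace K → ℂ) (W : ℂ) (Λ Λ' : ℂ → ℂ), 0 < A ∧ ‖W‖ = 1 ∧ Differentiable ℂ Λ ∧ Differentiable ℂ Λ' ∧ IsBoundedOnVerticalStrips Λ ∧ IsBoundedOnVerticalStrips Λ' ∧ (∀ s : ℂ, 1 < s.re → Λ s = HeckeCharacter.archGammaFactor a s * heckeLFunction χ s ∧ Λ' s = HeckeCharacter.archGammaFactor a' s * heckeLFunction χ⁻¹ s) ∧ ∀ s : ℂ, Λ s = W * (A : ℂ) ^ (1 / 2 - s) * Λ' (1 - s)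

/-- item stmt-Langlands-18974 · support · rank 9 · open · by planner
sources: CogdellPiatetskishapiro1994, TateThesis1967, LanglandsCorvallis1979Notion, JacquetShalikaAJM1981II, HeckeMathZ1920
[support] the FORMAL remainder of HeckeNiceBridge (C ⇒ C0) once the Hecke–Tate input is an explicit
hypothesis: HeckeLambdaNice → CPSConverseGL1 → MonomialInduction. For K/F finite, N = [K:F], and λ :
Γ_K → ℂ× not the restriction of a character of Γ_F, build D : TwistedStandardLData N F of Π(Ind_K^F
λ): S ⊇ the places under the ramification of K/F and of λ; α v = the N roots of ∏_{w∣v}(X^{f_w} −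
λ(Frob_w)) (card N, |·| = 1 so satake_norm_le with c = 0; (α v).prod = ∏_w (−1)^{f_w+1}λ(Frob_w) =
det(Ind λ)(Frob_v)); centralChar = the Hecke character of det(Ind λ)
(artinReciprocity_character_holds, proved); for a Hecke character ω of F let ψ =
λ^{Hecke}·(ω∘N_{K/F}) (a Hecke character of K; ψ is a norm twist iff λ comes from Γ_F — excluded)
and put twist.localFactor ω v := ∏_{w∣v, ψ unramified at w}(1 − ψ(ϖ_w)X^{f_w}) (constant term 1, deg
≤ N; off S it is eulerPolynomial((α v).map (ω(ϖ_v)·)) when ω is unramified at v since (ω∘N)(ϖ_w) =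
ω(ϖ_v)^{f_w}, and 1 when ω is ramified at v because N(𝒪_w×) = 𝒪_v× for unramified K_w/F_v),
dualTwist likewise with λ⁻¹, archShifts ω v = the shifts of HeckeLambdaNice for ψ₀ (ψ = ψ₀‖·‖^σ, ψ₀
unitary) regrouped along w ∣ v (Γ_ℂ(s) = Γ_ℝ(s)Γ_ℝ(s+1): card -/
@[route_item "route-Langlands-MonomialConverse"]
def HeckeNiceBridgeOfLambda : Prop :=
  HeckeLambdaNice → CPSConverseGL1 → MonomialInduction

/-- item stmt-Langlands-2908 · support · rank 9 · open · by planner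
sources: BuzzardGeeLMS2014, Gelbart1997, DoudMoore2006
[support] X → Langlands: the rest of the summit (regular / totally-real–CM sectors, other n and F,
direction (A), and the upgrade of the a.e. `IsPiOfArtinRep` to `Corresponds` at every finite place
by local–global compatibility + strong multiplicity one). Not this route's business; filed so that
the Assembly ends in the summit constant; shared junction for every even-Artin card. [difficulty:
open-problem] -/
@[route_item "route-Langlands-MonomialConverse", crux]
def EvenArtinJunction : Prop :=
  (∀ ρ : Literature.NumberTheory.GaloisRepresentations.FramedGaloisRep ℚ ℂ 2, ρ.toGaloisRep.IsIrreducible → Nonempty ((Matrix.ProjGenLinGroup.mk.comp ρ.toMonoidHom).range ≃* alternatingGroup (Fin 5)) → (∀ (φ : ℚ →+* ℝ) (c : Field.absoluteGaloisGroup ℚ), Literature.NumberTheory.GaloisRepresentations.IsComplexConjugation φ c → Matrix.GeneralLinearGroup.det (ρ c) = 1) → ∃ (hcpt : Literature.NumberTheory.Automorphic.isCompact_glFiniteIntegralLevel 2 ℚ) (π : Literature.NumberTheory.Automorphic.CuspidalAutomorphicRepData 2 ℚ hcpt), (∀ᶠ v : IsDedekindDomain.HeightOneSpectrum (NumberField.RingOfIntegers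 ℚ) in Filter.cofinite, ∃ α : Multiset ℂ, π.1.HasSatakeParamAt v α ∧ ρ.IsUnramifiedAt v ∧ ρ.HasFrobCharpolyAt v (Literature.NumberTheory.Automorphic.satakePolynomial α))) → _root_.Langlands

/-- item stmt-Langlands-18584 · assembly · rank 1 · closed · proved by Summit.Langlands.Langlands.Theorems.monomialConverse_assembly_proof (prover) · by planner
sources: CogdellPiatetskishapiro1994, ArthurClozelAMS120
[assembly] CPSConverseGL1 → AbelianFreeBrauer → HeckeNiceBridge → MurtyGlue → EvenArtinJunction →
Langlands. -/
@[route_item "route-Langlands-MonomialConverse"]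
def Assembly : Prop :=
  CPSConverseGL1 → AbelianFreeBrauer → HeckeNiceBridge → MurtyGlue → EvenArtinJunction → _root_.Langlands

-- `Assembly` holds: proved by `Summit.Langlands.Langlands.Theorems.monomialConverse_assembly_proof` (its module imports this route file, so no `_holds` link can be stated here).

/-! D-0027 §2.1 — DECIDING THEOREM (planner-authored via `route open/edit --closes-file`; by planner-plan-lens3-Langlands-embed-g2-0 2026-08-17T02:46:48Z):
its hypotheses are this route's items and its conclusion the sub-problem Statement (glue_lint), and it elaborates with this file. -/

@[closes "route-Langlands-MonomialConverse"] theorem closes (hC : CPSConverseGL1) (hK : AbelianFreeBrauer) (hB : HeckeNiceBridge)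
    (hG : MurtyGlue) (hJ : EvenArtinJunction) : _root_.Langlands :=
  hJ (fun ρ hirr _ _ => hG (hB hC) hK ℚ 2 le_rfl ρ hirr)

end Summit.Langlands.Langlands.Theses.MonomialConverse
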